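import Mathlib
import Summits.Ventures.PercRepro2.RowMinSplit

/-!
# The three-class split of (ROW-MIN) / (W-ROW-MIN), and (ROW-23-R)
(blind cell PercRepro2, night-3 g20, 2026-08-28; `proofs/NIGHT3-CERT.md` §29.9–§29.10)

CORRECTION of `RowMinSplit.lean`: the «F-half» there (`RowMinF` / `WRowMinF`: at every edge touching
none of `a₁, a₂, a₃` the type-`1` base dominates the DELETION) is FALSE at edges with BOTH ends
unmarked — weighted witness, marks distinct: `n = 7`, `(a₁, a₂, o, b, a₃) = (1, 5, 2, 6, 4)`, edges
`(1,3)` p = 1, `(0,3)` p = ¾ (= e), `(4,0)` ⅔, `(4,0)` 1, `(4,5)` ¼, `(6,3)` ¾, `(2,6)` ¾: the row is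
`(27/512, 81/2048, 0, 0)`, `N₁ < N₀`; typed witness with `o = b` (kit j303872; §29.10). Those two defs
are REFUTED candidates. What the data supports (three classes of the edge `g`):

* R — `g` touches a root or `a₃`: `N₁ ≥ N₃` (`RowMinR` / `WRowMinR` of `RowMinSplit.lean`);
* M — `g` touches `o` or `b` and no root / `a₃`: `N₁ ≥ N₀` (**`RowMinM` / `WRowMinM`**, CANDIDATES);
* U–U — both ends unmarked: only the disjunction `N₁ ≥ min (N₀, N₃)` (`RowMinUU` / `WRowMinUU`).

`rowMin_of_three`, `wrowMin_of_three`: the three classes give (ROW-MIN) / (W-ROW-MIN). Also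
**(ROW-23-R)** (`Row23R`, CANDIDATE): at a type-`2` edge touching a root or `a₃` the typed base is at
least TWICE the contraction, `N₂ ≥ 2 N₃` (min `N₂ / N₃` exactly `2` on the small cells; exhaustive
a = 5 every u, a = 6 every u on kit j304143); `row23_of_row23R`: it gives (ROW-23) at those edges.
Every def a CANDIDATE, NOT claimed proved. Own work; standard axioms.
-/

namespace Summit.Ventures.PercRepro2

open UnionCluster

namespace CovForm

section Three

variable {V : Type*} {E : Type*} [Fintype E] [DecidableEq E] {R : Type*} [Field R]
  [LinearOrder R] [IsStrictOrderedRing R]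

/-- The edge touches `o` or `b`. -/
def TouchesMarks (ends : E → Sym2 V) (o b : V) (e : E) : Prop := o ∈ ends e ∨ b ∈ ends e

/-- **(ROW-MIN-M), a CANDIDATE (not claimed proved)**: at a type-`1` edge touching `o` or `b` but no
root and not `a₃`, the typed base dominates the deletion. -/
def RowMinM (ends : E → Sym2 V) (o a₁ a₂ a₃ b : V) : Prop :=
  ∀ (F : Finset E) (z : Config E) (τ : E → ℕ) (g : E), g ∈ F → τ g = 1 →
    (∀ e ∈ F, τ e = 1 ∨ τ e = 2) → ¬ TouchesRoots ends a₁ a₂ a₃ g → TouchesMarks ends o b g →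
    typedCount F z (Function.update τ g 0)
        (K3 ends o a₁ a₂ a₃ b : Config E → Config E → Config E → R) ≤
      typedCount F z τ (K3 ends o a₁ a₂ a₃ b)

/-- (ROW-MIN) restricted to the edges with both ends unmarked — the disjunctive form stays. -/
def RowMinUU (ends : E → Sym2 V) (o a₁ a₂ a₃ b : V) : Prop :=
  ∀ (F : Finset E) (z : Config E) (τ : E → ℕ) (g : E), g ∈ F → τ g = 1 →
    (∀ e ∈ F, τ e = 1 ∨ τ e = 2) → ¬ TouchesRoots ends a₁ a₂ a₃ g → ¬ TouchesMarks ends o b g →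
    typedCount F z (Function.update τ g 0)
        (K3 ends o a₁ a₂ a₃ b : Config E → Config E → Config E → R) ≤
      typedCount F z τ (K3 ends o a₁ a₂ a₃ b) ∨
    typedCount F z (Function.update τ g 3)
        (K3 ends o a₁ a₂ a₃ b : Config E → Config E → Config E → R) ≤
      typedCount F z τ (K3 ends o a₁ a₂ a₃ b)

omit [IsStrictOrderedRing R] in
/-- The three classes give (ROW-MIN). -/
theorem rowMin_of_three (ends : E → Sym2 V) (o a₁ a₂ a₃ b : V)
    (hR : RowMinR (R := R) ends o a₁ a₂ a₃ b) (hM : RowMinM (R := R) ends o a₁ a₂ a₃ b)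
    (hU : RowMinUU (R := R) ends o a₁ a₂ a₃ b) : RowMin (R := R) ends o a₁ a₂ a₃ b := by
  intro F z τ g hg hg1 hτ
  by_cases ht : TouchesRoots ends a₁ a₂ a₃ g
  · exact Or.inr (hR F z τ g hg hg1 hτ ht)
  · by_cases hm : TouchesMarks ends o b g
    · exact Or.inl (hM F z τ g hg hg1 hτ ht hm)
    · exact hU F z τ g hg hg1 hτ ht hm

/-- **(W-ROW-MIN-M), a CANDIDATE (not claimed proved)**: at an edge touching `o` or `b` but no
root and not `a₃`, the one-typed-edge (type `1`) sum dominates `p_e (1 − p_e)²` times the cubic form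
of the deletion. -/
def WRowMinM (ends : E → Sym2 V) (o a₁ a₂ a₃ b : V) : Prop :=
  ∀ (p : E → R), IsProbVec p → ∀ (e : E) (τ : E → ℕ), ¬ TouchesRoots ends a₁ a₂ a₃ e →
    TouchesMarks ends o b e →
    p e * (1 - p e) ^ 2 * Gc (Function.update p e 0) ends o a₁ a₂ a₃ b ≤
      triSum p {e} (Function.update τ e 1) (K3 ends o a₁ a₂ a₃ b)

/-- (W-ROW-MIN) restricted to the edges with both ends unmarked. -/
def WRowMinUU (ends : E → Sym2 V) (o a₁ a₂ a₃ b : V) : Prop :=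
  ∀ (p : E → R), IsProbVec p → ∀ (e : E) (τ : E → ℕ), ¬ TouchesRoots ends a₁ a₂ a₃ e →
    ¬ TouchesMarks ends o b e →
    p e * (1 - p e) ^ 2 * Gc (Function.update p e 0) ends o a₁ a₂ a₃ b ≤
        triSum p {e} (Function.update τ e 1) (K3 ends o a₁ a₂ a₃ b) ∨
      p e * (1 - p e) ^ 2 * Gc (Function.update p e 1) ends o a₁ a₂ a₃ b ≤
        triSum p {e} (Function.update τ e 1) (K3 ends o a₁ a₂ a₃ b)

omit [IsStrictOrderedRing R] in
/-- The three classes give (W-ROW-MIN). -/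
theorem wrowMin_of_three (ends : E → Sym2 V) (o a₁ a₂ a₃ b : V)
    (hR : WRowMinR (R := R) ends o a₁ a₂ a₃ b) (hM : WRowMinM (R := R) ends o a₁ a₂ a₃ b)
    (hU : WRowMinUU (R := R) ends o a₁ a₂ a₃ b) : WRowMin (R := R) ends o a₁ a₂ a₃ b := by
  intro p hp e τ
  by_cases ht : TouchesRoots ends a₁ a₂ a₃ e
  · exact Or.inr (hR p hp e τ ht)
  · by_cases hm : TouchesMarks ends o b e
    · exact Or.inl (hM p hp e τ ht hm)
    · exact hU p hp e τ ht hm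

/-- **(ROW-23-R), a CANDIDATE (not claimed proved)**: at a type-`2` edge touching a root or `a₃`
the typed base is at least twice the contraction. -/
def Row23R (ends : E → Sym2 V) (o a₁ a₂ a₃ b : V) : Prop :=
  ∀ (F : Finset E) (z : Config E) (τ : E → ℕ) (g : E), g ∈ F → τ g = 2 →
    (∀ e ∈ F, τ e = 1 ∨ τ e = 2) → TouchesRoots ends a₁ a₂ a₃ g →
    2 * typedCount F z (Function.update τ g 3)
        (K3 ends o a₁ a₂ a₃ b : Config E → Config E → Config E → R) ≤
      typedCount F z τ (K3 ends o a₁ a₂ a₃ b)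

/-- (ROW-23-R) gives (ROW-23) at the edges touching a root or `a₃`, provided the contraction is
nonnegative there. -/
theorem row23_of_row23R (ends : E → Sym2 V) (o a₁ a₂ a₃ b : V)
    (h : Row23R (R := R) ends o a₁ a₂ a₃ b) (F : Finset E) (z : Config E) (τ : E → ℕ) (g : E)
    (hg : g ∈ F) (hg2 : τ g = 2) (hτ : ∀ e ∈ F, τ e = 1 ∨ τ e = 2)
    (ht : TouchesRoots ends a₁ a₂ a₃ g)
    (hcon : 0 ≤ typedCount F z (Function.update τ g 3)
      (K3 ends o a₁ a₂ a₃ b : Config E → Config E → Config E → R)) :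
    typedCount F z (Function.update τ g 3)
        (K3 ends o a₁ a₂ a₃ b : Config E → Config E → Config E → R) ≤
      typedCount F z τ (K3 ends o a₁ a₂ a₃ b) := by
  have := h F z τ g hg hg2 hτ ht
  linarith

end Three

end CovForm

end Summit.Ventures.PercRepro2
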